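import Summits.KontsevichZagierPeriods.KontsevichZagierPeriods.Theorems.RootDecompRationalCubeDichotomySimpleBranchRootIso

/-!
# Route RootDecompRationalCubeDichotomy — item 27842 `PiRationalisationSimpleBranch` PROVED, part 4/11 (`RootDecompRationalCubeDichotomySimpleBranchReImPoly`)

Theorems-split (≤ 400 lines each, sequential imports) of the decomp-kz lens-2 gen-4 file
`run/shared/lean/pub/decomp-kz/decomp-kz-lens-2/g4/PiRationalisationSimpleBranch27842.lean` (2963 lines; lens farm rc 0, writer re-check
rc 0 audit proof-of-item closed:true, critic g2 by-name probe std axioms, 2026-08-30T05:27:57Z/06:02:52Z). The rung: for simple-branch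
Nash data (`F(x,g) = 0`, `∂_z F(x,g) ≠ 0` on the closed cube) `[π]^K·[s] ∈ relations ⊔ ⟨rational closed-cube sector⟩` for all `K ≥ 1` —
root isolation on rational sub-boxes, the Green band move (planar Stokes inside the four moves), the half winding number ≡ 4[A] ≡ [π],
box rescaling, and `PiTimesSector` (item 26388, landed). The final part closes the ROUTE ITEM by name
(`piRationalisationSimpleBranch_proof`). Sector lemmas are REUSED from the landed rung-24903 file `…PiRationalisationSqrtMoves`.
[Kontsevich–Zagier 2001 §1.2; argument principle] Standard axioms, 0 sorry.
-/

noncomputable section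

set_option linter.dupNamespace false

namespace Summit.KontsevichZagierPeriods.RootDecompRationalCubeDichotomy.Rung27842.ReIm

open MvPolynomial QuadraticAlgebra
variable {n : ℕ}

/-! ## Part 2: polynomial functions of one complex variable with real parameters; line derivatives -/

/-- `N(x, z)` for real parameters `x` and complex `z`. -/
def polC (N : MvPolynomial (Fin (n + 1)) ℚ) (x : Fin n → ℝ) (z : ℂ) : ℂ :=
  aeval (Fin.snoc (fun i => ((x i : ℝ) : ℂ)) z : Fin (n + 1) → ℂ) N

/-- `z ↦ N(x,z)` is complex-differentiable with derivative `(∂_z N)(x,z)`. -/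
theorem hasDerivAt_polC (N : MvPolynomial (Fin (n + 1)) ℚ) (x : Fin n → ℝ) (z : ℂ) :
    HasDerivAt (polC N x) (polC (pderiv (Fin.last n) N) x z) z := by
  induction N using MvPolynomial.induction_on generalizing z with
  | C a =>
    have h : polC (C a : MvPolynomial (Fin (n + 1)) ℚ) x = fun _ => algebraMap ℚ ℂ a := by
      funext w; simp [polC]
    rw [h]
    simpa [polC] using hasDerivAt_const z (algebraMap ℚ ℂ a)
  | add p q hp hq =>
    have h : polC (p + q) x = fun w => polC p x w + polC q x w := by funext w; simp [polC]
    rw [h]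
    exact ((hp z).add (hq z)).congr_deriv (by simp [polC])
  | mul_X p i hp =>
    rcases Fin.eq_castSucc_or_eq_last i with ⟨j, rfl⟩ | rfl
    · have h : polC (p * X (Fin.castSucc j)) x = fun w => polC p x w * ((x j : ℝ) : ℂ) := by
        funext w; simp [polC]
      rw [h]
      exact ((hp z).mul_const ((x j : ℝ) : ℂ)).congr_deriv
        (by simp [polC, pderiv_X_of_ne (Fin.castSucc_lt_last j).ne]; ring)
    · have h : polC (p * X (Fin.last n)) x = fun w => polC p x w * w := by
        funext w; simp [polC]
      rw [h]
      exact ((hp z).mul (hasDerivAt_id' z)).congr_deriv (by simp [polC]; ring)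

/-- Numerator and denominator of `∂_z (N/D) = (N_z D − N D_z)/D²`. -/
def dNum (N D : MvPolynomial (Fin (n + 1)) ℚ) : MvPolynomial (Fin (n + 1)) ℚ :=
  pderiv (Fin.last n) N * D - N * pderiv (Fin.last n) D

/-- Denominator `D²` of the derivative quotient. -/
def dDen (D : MvPolynomial (Fin (n + 1)) ℚ) : MvPolynomial (Fin (n + 1)) ℚ := D * D

/-- Quotient rule for `z ↦ N(x,z)/D(x,z)` off the zeros of `D`. -/
theorem hasDerivAt_ratC (N D : MvPolynomial (Fin (n + 1)) ℚ) (x : Fin n → ℝ) (z : ℂ) (hD : polC D x z ≠ 0) :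
    HasDerivAt (fun w => polC N x w / polC D x w) (polC (dNum N D) x z / polC (dDen D) x z) z := by
  exact ((hasDerivAt_polC N x z).div (hasDerivAt_polC D x z) hD).congr_deriv (by simp [dNum, dDen, polC, sq])

/-- Chain rule along a vertical line `t ↦ u + it`. -/
theorem hasDerivAt_vertical {H : ℂ → ℂ} {H' : ℂ} {u v : ℝ}
    (h : HasDerivAt H H' ((u : ℂ) + (v : ℂ) * Complex.I)) :
    HasDerivAt (fun t : ℝ => H ((u : ℂ) + (t : ℂ) * Complex.I)) (H' * Complex.I) v := by
  have hγ : HasDerivAt (fun t : ℝ => (u : ℂ) + (t : ℂ) * Complex.I) Complex.I v := by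
    have := ((Complex.ofRealCLM.hasDerivAt (x := v)).mul_const Complex.I).const_add (u : ℂ)
    simpa using this
  exact h.comp v hγ

/-- Chain rule along a horizontal line `t ↦ t + iv`. -/
theorem hasDerivAt_horizontal {H : ℂ → ℂ} {H' : ℂ} {u v : ℝ}
    (h : HasDerivAt H H' ((u : ℂ) + (v : ℂ) * Complex.I)) :
    HasDerivAt (fun t : ℝ => H ((t : ℂ) + (v : ℂ) * Complex.I)) H' u := by
  have hγ : HasDerivAt (fun t : ℝ => (t : ℂ) + (v : ℂ) * Complex.I) 1 u := by
    have := (Complex.ofRealCLM.hasDerivAt (x := u)).add_const ((v : ℂ) * Complex.I)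
    simpa using this
  simpa [Function.comp_def] using (h.comp u hγ)

/-- Real part of a differentiable curve `ℝ → ℂ`. -/
theorem hasDerivAt_re_comp {φ : ℝ → ℂ} {φ' : ℂ} {t : ℝ} (h : HasDerivAt φ φ' t) :
    HasDerivAt (fun s => (φ s).re) φ'.re t := by
  simpa [Function.comp_def] using Complex.reCLM.hasFDerivAt.comp_hasDerivAt t h

/-- Imaginary part of a differentiable curve `ℝ → ℂ`. -/
theorem hasDerivAt_im_comp {φ : ℝ → ℂ} {φ' : ℂ} {t : ℝ} (h : HasDerivAt φ φ' t) :
    HasDerivAt (fun s => (φ s).im) φ'.im t := by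
  simpa [Function.comp_def] using Complex.imCLM.hasFDerivAt.comp_hasDerivAt t h

/-! ## Part 3: `Re/Im (N/D)` as real functions of `w = (x,u,v)`; the Green-move data -/

/-- `Re (N(x,u+iv)/D(x,u+iv))`. -/
def ratRe (N D : MvPolynomial (Fin (n + 1)) ℚ) (w : Fin (n + 2) → ℝ) : ℝ :=
  (aeval (cplxPoint w) N / aeval (cplxPoint w) D).re

/-- `Im (N(x,u+iv)/D(x,u+iv))`. -/
def ratIm (N D : MvPolynomial (Fin (n + 1)) ℚ) (w : Fin (n + 2) → ℝ) : ℝ :=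
  (aeval (cplxPoint w) N / aeval (cplxPoint w) D).im

/-- Auxiliary step `aeval_normSqP_ne_zero`. [bookkeeping] -/
theorem aeval_normSqP_ne_zero (D : MvPolynomial (Fin (n + 1)) ℚ) (w : Fin (n + 2) → ℝ)
    (hD : aeval (cplxPoint w) D ≠ 0) : aeval w (reP D ^ 2 + imP D ^ 2) ≠ 0 := by
  rw [← normSq_aeval_cplxPoint]; exact (Complex.normSq_pos.2 hD).ne'

/-- ℚ-rational formula for the real part. -/
theorem ratRe_eq (N D : MvPolynomial (Fin (n + 1)) ℚ) (w : Fin (n + 2) → ℝ) :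
    ratRe N D w = aeval w (reP N * reP D + imP N * imP D) / aeval w (reP D ^ 2 + imP D ^ 2) := by
  simp only [ratRe, Complex.div_re, re_aeval_cplxPoint, im_aeval_cplxPoint, normSq_aeval_cplxPoint, map_add,
    map_mul, map_pow]
  rw [← add_div]

/-- ℚ-rational formula for the imaginary part. -/
theorem ratIm_eq (N D : MvPolynomial (Fin (n + 1)) ℚ) (w : Fin (n + 2) → ℝ) :
    ratIm N D w = aeval w (imP N * reP D - reP N * imP D) / aeval w (reP D ^ 2 + imP D ^ 2) := by
  simp only [ratIm, Complex.div_im, re_aeval_cplxPoint, im_aeval_cplxPoint, normSq_aeval_cplxPoint, map_add,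
    map_sub, map_mul, map_pow]
  rw [← sub_div]

open Literature.NumberTheory.Transcendental in
/-- `Re(N/D)` is ℚ-semialgebraic off the zeros of `D`. -/
theorem isSemialgebraicFunOn_ratRe (N D : MvPolynomial (Fin (n + 1)) ℚ) {s : Set (Fin (n + 2) → ℝ)}
    (hs : Literature.ModelTheory.ExponentialFields.IsSemialgebraic ℚ s) (hD : ∀ w ∈ s, aeval (cplxPoint w) D ≠ 0) :
    IsSemialgebraicFunOn ℚ s (ratRe N D) :=
  (isSemialgebraicFunOn_aeval_div_aeval hs (reP N * reP D + imP N * imP D) (reP D ^ 2 + imP D ^ 2)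
    (fun w hw => aeval_normSqP_ne_zero D w (hD w hw))).congr (fun w _ => (ratRe_eq N D w).symm)

open Literature.NumberTheory.Transcendental in
/-- `Im(N/D)` is ℚ-semialgebraic off the zeros of `D`. -/
theorem isSemialgebraicFunOn_ratIm (N D : MvPolynomial (Fin (n + 1)) ℚ) {s : Set (Fin (n + 2) → ℝ)}
    (hs : Literature.ModelTheory.ExponentialFields.IsSemialgebraic ℚ s) (hD : ∀ w ∈ s, aeval (cplxPoint w) D ≠ 0) :
    IsSemialgebraicFunOn ℚ s (ratIm N D) :=
  (isSemialgebraicFunOn_aeval_div_aeval hs (imP N * reP D - reP N * imP D) (reP D ^ 2 + imP D ^ 2)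
    (fun w hw => aeval_normSqP_ne_zero D w (hD w hw))).congr (fun w _ => (ratIm_eq N D w).symm)

/-- `cplxPoint` of a point written `Fin.snoc y s` (`y = (x,u)`, `s = v`). -/
theorem cplxPoint_snoc (y : Fin (n + 1) → ℝ) (s : ℝ) :
    cplxPoint (Fin.snoc y s) =
      (Fin.snoc (fun i => ((y (Fin.castSucc i) : ℝ) : ℂ)) (((y (Fin.last n) : ℝ) : ℂ) + (s : ℂ) * Complex.I) :
        Fin (n + 1) → ℂ) := by
  ext i
  refine Fin.lastCases ?_ (fun j => ?_) i
  · simp [cplxPoint]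
  · simp [cplxPoint]

/-- Auxiliary step `aeval_cplxPoint_snoc`. [bookkeeping] -/
theorem aeval_cplxPoint_snoc (y : Fin (n + 1) → ℝ) (s : ℝ) (M : MvPolynomial (Fin (n + 1)) ℚ) :
    aeval (cplxPoint (Fin.snoc y s)) M =
      polC M (fun i => y (Fin.castSucc i)) (((y (Fin.last n) : ℝ) : ℂ) + (s : ℂ) * Complex.I) := by
  rw [cplxPoint_snoc]; rfl

/-- Auxiliary step `aeval_cplxPoint_snoc_snoc`. [bookkeeping] -/
theorem aeval_cplxPoint_snoc_snoc (x : Fin n → ℝ) (s v : ℝ) (M : MvPolynomial (Fin (n + 1)) ℚ) :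
    aeval (cplxPoint (Fin.snoc (Fin.snoc x s : Fin (n + 1) → ℝ) v)) M = polC M x ((s : ℂ) + (v : ℂ) * Complex.I) := by
  rw [cplxPoint_snoc_snoc]; rfl

/-- **Vertical derivative of `Im(N/D)`** = `Re (N/D)'` (the `hPder` datum of the Green move with `P = Im h`). -/
theorem hasDerivAt_ratIm_vertical (N D : MvPolynomial (Fin (n + 1)) ℚ) (y : Fin (n + 1) → ℝ) (t : ℝ)
    (hD : aeval (cplxPoint (Fin.snoc y t)) D ≠ 0) :
    HasDerivAt (fun s : ℝ => ratIm N D (Fin.snoc y s)) (ratRe (dNum N D) (dDen D) (Fin.snoc y t)) t := by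
  rw [aeval_cplxPoint_snoc] at hD
  have h2 := hasDerivAt_im_comp (hasDerivAt_vertical (hasDerivAt_ratC N D _ _ hD))
  have hfun : (fun s : ℝ => ratIm N D (Fin.snoc y s)) = fun s : ℝ =>
      (polC N (fun i => y (Fin.castSucc i)) (((y (Fin.last n) : ℝ) : ℂ) + (s : ℂ) * Complex.I) /
        polC D (fun i => y (Fin.castSucc i)) (((y (Fin.last n) : ℝ) : ℂ) + (s : ℂ) * Complex.I)).im := by
    funext s; simp only [ratIm, aeval_cplxPoint_snoc]
  rw [hfun]
  convert h2 using 1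
  simp only [ratRe, aeval_cplxPoint_snoc, Complex.mul_im, Complex.I_re, Complex.I_im, mul_zero, mul_one, add_zero]

/-- **Horizontal derivative of `Re(N/D)`** = `Re (N/D)'` (the `hQder` datum of the Green move with `Q = Re h`). -/
theorem hasDerivAt_ratRe_horizontal (N D : MvPolynomial (Fin (n + 1)) ℚ) (x : Fin n → ℝ) (v t : ℝ)
    (hD : aeval (cplxPoint (Fin.snoc (Fin.snoc x t : Fin (n + 1) → ℝ) v)) D ≠ 0) :
    HasDerivAt (fun s : ℝ => ratRe N D (Fin.snoc (Fin.snoc x s : Fin (n + 1) → ℝ) v))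
      (ratRe (dNum N D) (dDen D) (Fin.snoc (Fin.snoc x t : Fin (n + 1) → ℝ) v)) t := by
  rw [aeval_cplxPoint_snoc_snoc] at hD
  have h2 := hasDerivAt_re_comp (hasDerivAt_horizontal (hasDerivAt_ratC N D _ _ hD))
  have hfun : (fun s : ℝ => ratRe N D (Fin.snoc (Fin.snoc x s : Fin (n + 1) → ℝ) v)) = fun s : ℝ =>
      (polC N x ((s : ℂ) + (v : ℂ) * Complex.I) / polC D x ((s : ℂ) + (v : ℂ) * Complex.I)).re := by
    funext s; simp only [ratRe, aeval_cplxPoint_snoc_snoc]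
  rw [hfun]
  convert h2 using 1
  simp only [ratRe, aeval_cplxPoint_snoc_snoc]

/-- Continuity of `Im(N/D)` along a closed vertical fibre off the zeros of `D` (the `hPcont` datum). -/
theorem continuousOn_ratIm_vertical (N D : MvPolynomial (Fin (n + 1)) ℚ) (y : Fin (n + 1) → ℝ) {S : Set ℝ}
    (hD : ∀ s ∈ S, aeval (cplxPoint (Fin.snoc y s)) D ≠ 0) :
    ContinuousOn (fun s : ℝ => ratIm N D (Fin.snoc y s)) S :=
  fun s hs => (hasDerivAt_ratIm_vertical N D y s (hD s hs)).continuousAt.continuousWithinAt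

/-- Continuity of `Re(N/D)` along a closed horizontal fibre off the zeros of `D` (the `hQcont` datum). -/
theorem continuousOn_ratRe_horizontal (N D : MvPolynomial (Fin (n + 1)) ℚ) (x : Fin n → ℝ) (v : ℝ) {S : Set ℝ}
    (hD : ∀ s ∈ S, aeval (cplxPoint (Fin.snoc (Fin.snoc x s : Fin (n + 1) → ℝ) v)) D ≠ 0) :
    ContinuousOn (fun s : ℝ => ratRe N D (Fin.snoc (Fin.snoc x s : Fin (n + 1) → ℝ) v)) S :=
  fun s hs => (hasDerivAt_ratRe_horizontal N D x v s (hD s hs)).continuousAt.continuousWithinAt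

/-- Joint continuity of `Re(N/D)` off the zeros of `D` (for building band representations with `contRep`). -/
theorem continuousOn_ratRe (N D : MvPolynomial (Fin (n + 1)) ℚ) {s : Set (Fin (n + 2) → ℝ)}
    (hD : ∀ w ∈ s, aeval (cplxPoint w) D ≠ 0) : ContinuousOn (ratRe N D) s := by
  have hc : ∀ M : MvPolynomial (Fin (n + 2)) ℚ, Continuous (fun w : Fin (n + 2) → ℝ => aeval w M) :=
    fun M => Literature.ModelTheory.ExponentialFields.continuous_aeval_real M
  have h : ContinuousOn (fun w => aeval w (reP N * reP D + imP N * imP D) / aeval w (reP D ^ 2 + imP D ^ 2)) s :=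
    (hc _).continuousOn.div (hc _).continuousOn (fun w hw => aeval_normSqP_ne_zero D w (hD w hw))
  exact h.congr (fun w _ => ratRe_eq N D w)

/-- Joint continuity of `Im(N/D)` off the zeros of `D`. -/
theorem continuousOn_ratIm (N D : MvPolynomial (Fin (n + 1)) ℚ) {s : Set (Fin (n + 2) → ℝ)}
    (hD : ∀ w ∈ s, aeval (cplxPoint w) D ≠ 0) : ContinuousOn (ratIm N D) s := by
  have hc : ∀ M : MvPolynomial (Fin (n + 2)) ℚ, Continuous (fun w : Fin (n + 2) → ℝ => aeval w M) :=
    fun M => Literature.ModelTheory.ExponentialFields.continuous_aeval_real M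
  have h : ContinuousOn (fun w => aeval w (imP N * reP D - reP N * imP D) / aeval w (reP D ^ 2 + imP D ^ 2)) s :=
    (hc _).continuousOn.div (hc _).continuousOn (fun w hw => aeval_normSqP_ne_zero D w (hD w hw))
  exact h.congr (fun w _ => ratIm_eq N D w)

end Summit.KontsevichZagierPeriods.RootDecompRationalCubeDichotomy.Rung27842.ReIm
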